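import Literature.NumberTheory.Automorphic.Liu2021.LemD1AsPrintedIndexedNonVacuityNonsplitPlace
import Literature.NumberTheory.Automorphic.Liu2021.LemD1FamilyOfPlace
import Literature.NumberTheory.Automorphic.Liu2021.LemD1AsPrintedIndexed
import Literature.NumberTheory.Automorphic.UnitaryGroupNonsplitPlace
import Literature.NumberTheory.GaloisRepresentations.HeckeCharacter
import Literature.NumberTheory.GelbartRogawski1991.CMSplittingCharLocalMu
import Literature.RepresentationTheory.Liu2021.OscillatorConventions
import Literature.NumberTheory.Automorphic.ConjugateSelfDualCharacters
import Literature.NumberTheory.Automorphic.IdeleClassCharacterHecke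
import Literature.RingTheory.DiscreteValuationRing.AdicCompletionResidueField
import Mathlib.GroupTheory.FiniteAbelian.Duality
import Mathlib.RingTheory.RootsOfUnity.AlgebraicallyClosed
import Mathlib.Analysis.Complex.Polynomial.Basic
import Mathlib.NumberTheory.NumberField.Ideal.Basic
import HarnessLib

/-!
# [Liu2021, App. D §D.1 Step 2 ∕ Lemma D.1 (3)] — the TAME TWIST: next to every Step-2 datum of the place model there is a
# DIFFERENT one at every finite place `∤ 2` (split, inert or ramified); the μ-teeth of (3) AS PRINTED bite at non-split places

Reproduction ∕ bookkeeping (Literature, THEOREMS ONLY: no definition, no record, no named fact, no `sorry`; nothing is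
asserted about Liu's oscillator representations or about the tree's constructed local Weil carriers).

Sequel of `LemD1AsPrintedIndexedNonVacuityNonsplitPlace.lean` (whose «What this does NOT give» names «a second, DIFFERENT Step-2
character at a non-split place … hence no two-`μ`-label (1) ∧ (3) collection at a non-split place») and of `…InertRigidity.lean` ∕
`…RamifiedPlace.lean` (at an inert place the UNRAMIFIED Step-2 datum is unique; at a ramified place every Step-2 datum is ramified).
Setting: the tree's place model of a quadratic extension `E/F` of number fields at a finite place `v` (`F_v = v.adicCompletion F`,
`E_v = UnitaryGroup.LocalRing E v = Π_{w∣v} E_w`, `c ⊗ 1 = conjLocal`, Step 1's representative `ε = δ ⊗ 1 = LemD1OfPlace.eps`, `c δ = −δ ≠ 0`),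
and a place `w ∣ v` NOT above `2`.  A «Step-2 datum» is the rows' displayed binder shape: `μ : E_vˣ → ℂˣ` unitary, continuous, with
the printed clause «`μ(ι_v a) = 1 ↔ a ∈ Nm E_vˣ`» ([Liu2021, App. D §D.1 Step 2, l. 5219: «Choose a character `μ : E^× → ℂ^1` such that
`μ|_{F^×}` is the unique character whose kernel is exactly `Nm_{E/F} E^×`»); its packaged form is `LemD1OfPlace.muOf … ∈ LemD1.MuSet S`.

* §1 (any number field `E`, place `w ∤ 2`) **`exists_tame_character`**: a character `θ_w : E_wˣ → ℂˣ` of FINITE ORDER with OPEN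
  KERNEL, unitary, trivial on the principal units `1 + 𝔭_w`, and `θ_w(−1) ≠ 1`.  Construction: `E_wˣ → 𝒪_wˣ` (unit part `x · ϖ_w^{ord x}`,
  `ϖ_w = HeckeCharacter.uniformizer`), `𝒪_wˣ → κ(w)ˣ` (Mathlib `ValuationSubring.unitGroupToResidueFieldUnits`, kernel = principal units),
  and a character of the finite group `κ(w)ˣ` not killing `−1 ≠ 1` (`2 ∉ w`; residue field of `𝒪_w` = `𝓞 E ⧸ w`, tree
  `AdicCompletionResidueField`; characters of a finite abelian group separate points, Mathlib `CommGroup.exists_apply_ne_one_of_hasEnoughRootsOfUnity`)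
  — the `μ_{q−1}`-factor of `E_wˣ = (ϖ) × μ_{q−1} × U^{(1)}` [NeukirchANT1999, Ch. II §5 Prop. (5.3)].
* §2 **`exists_twistChar`**: the tame twisting character `χ(x) := θ_w((x · ((c ⊗ 1) x)⁻¹)_w)` of `E_vˣ` — unitary, continuous, of finite
  order, TRIVIAL on every `(c ⊗ 1)`-fixed unit (in particular on `ι_v(F_vˣ)`), and `χ(ε) = θ_w(ε_w / c_w ε_w) = θ_w(−1) = −1`.
* §3 **`exists_stepTwo_twist`**: for EVERY Step-2 datum `μ` the product `μ' = μ · χ` is a Step-2 datum (the printed clause only sees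
  `ι_v(F_vˣ)`, where `χ = 1`: `stepTwo_clause_mul`) with `μ'(ε) = −μ(ε)`, so `μ' ≠ μ`; `MuSet` ∕ `muOf` forms `exists_muSet_ne_twist`,
  `exists_muOf_ne_twist`.  **`exists_stepTwo_apply_unit_ne_one`**: at a place with an INERT WITNESS `π ∈ F_vˣ` (`v_w(ι_w π) = exp(−1)`),
  next to every Step-2 datum there is one which is NOT unramified (`≠ 1` at the unit `u = ε · (ι_v π)^{ord_w ε}` of `w`-valuation `1`,
  where `χ(u) = −1`) — so, with `…InertRigidity` and `…RamifiedPlace` §4, at every non-split place of odd residue characteristic carrying a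
  Step-2 datum there is a RAMIFIED one, although the unramified one is unique (inert) or absent (ramified).
* §4 **`exists_lemD1IndexedFamily_item1_not_lemD1_3_twist`** (rank `N ≥ 3`): for every `μ ∈ MuSet S` and every representative `e`, the
  two-member collection `(μ, e, 1)`, `(μ', e, 1)` on trivial-line carriers satisfies [Lem. D.1, first sentence + (1)] AS PRINTED member by
  member (rank `≠ 2`, both sides of (1) false) and VIOLATES `LemD1_3AsPrintedI` (isomorphic — equal — `ω`'s, `μ ≠ μ'`); hence
  `not_forall_lemD1_3_of_item1_twist`: at every place `∤ 2` carrying a Step-2 datum, (3) AS PRINTED is NOT a consequence of (1).  In the tree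
  so far only at SPLIT places (`…AtPlace` §6, §9) or under `∃ x, μ(x)² ≠ 1` (`…AtPlace` §8, `…WeightOne`).
* §5 the CM rows (`L` CM, `F = L⁺`, `c` = complex conjugation, `δ = imagUnit L`, the rows' own `μ_v = localMu L (toHeckeCharacter L ψ) v`
  for a conjugate symplectic `ψ`, [Liu2021, Def. 4.1 ∕ 4.11]): at EVERY place `v ∤ 2` of `L⁺` — **`exists_muOf_ne_localMu_twist`** (a
  companion `μ'`, `μ'(ε) = −μ_v(ε)`, `muOf μ' ≠ muOf μ_v` with VERBATIM the rows' displayed proofs), **`exists_muSet_ne_of_isCMField`** (the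
  printed Step-2 index set of the rows' standing data has two elements; cofinite form `eventually_exists_muSet_ne`),
  **`exists_lemD1IndexedFamily_item1_not_lemD1_3_localMu_twist`** (the μ-teeth of (3) with the rows' own `μ_v` as one label — at a
  NON-SPLIT place this is new), **`exists_muSet_apply_unit_ne_one_of_inertWitness`** (a ramified element at every place with an inert
  witness, although the rows' own label is unramified there whenever `ψ` is).

What this does NOT give: that the companion `μ'` is ITSELF a rows' label `localMu L (toHeckeCharacter L ψ') v` for another conjugate
symplectic `ψ'` of the same ∞-type (globalisation of `θ_w` by [ClozelHarrisTaylor2008, Lem. 4.1.1] — the sequel); places above `2`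
(there `−1 ∈ 1 + 𝔭_w` and a wild character would be needed); a Step-2 datum at a non-split place of a GENERAL (non-CM) `E/F` to start
from; a NON-QUADRATIC twist (`χ² = 1` on `ε`; `χ` has order `> 2` in general but no element of order `> 2` is exhibited); anything about
the rows' carriers `𝓢.omegaLoc v` or `χ_v`; Lem. D.1 itself.  HC_CM is NOT proved.

Cell pub-hodgecm2 (COR-CM), audit class of the END rows `hD1''` ∕ `hD3`; seat prover-pub-hodgecm2-b10.

References: [Liu2021] Y. Liu, *Fourier–Jacobi cycles and arithmetic relative trace formula*, Camb. J. Math. 9 (2021) =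
arXiv:2102.11518, App. D §D.1 Steps 1–2 (`FJcycle.tex` l. 5217–5219), Lemma D.1 (1) (l. 5229), (3) (l. 5233), Def. 4.1
(l. 1900–1902), Def. 4.11 (l. 2086); [NeukirchANT1999] J. Neukirch, *Algebraic Number Theory* (1999), Ch. II §5 Prop. (5.3)
(`K^* = (π) × μ_{q−1} × U^{(1)}`), Ch. I §8 (primes above a prime); [CasselsFrohlichANT1967] Ch. II §10 (`L ⊗_K K_v = Π_{w∣v} L_w`,
valuations under the Galois action).
-/

noncomputable section

open scoped Matrix MatrixGroups
open NumberField IsDedekindDomain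
open Literature.RepresentationTheory
open Literature.RepresentationTheory.CentralCharacterQuotient (augmentation quotRep quotRep_mk)
open Literature.NumberTheory.GaloisRepresentations (HeckeCharacter)

namespace Literature.NumberTheory.Automorphic.Liu2021.LemD1IndexedNonVacuityTameTwist

/-! ## §1 A tame character of `E_wˣ` at a place `w ∤ 2`: finite order, open kernel, trivial on `1 + 𝔭_w`, `θ_w(−1) ≠ 1` -/

section Local

variable {E : Type} [Field E] [NumberField E] (w : HeightOneSpectrum (𝓞 E))

/-- **the unit-part homomorphism `E_wˣ → 𝒪_wˣ`, `x ↦ x · ϖ_w^{ord_w x}`** (`ϖ_w = HeckeCharacter.uniformizer E w`, `v_w(ϖ_w) = exp(−1)`,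
`exp(ord_w x) := v_w(x)`), the identity on `𝒪_wˣ` — the projection of `E_wˣ = (ϖ_w) × 𝒪_wˣ` onto the second factor.
[cite: NeukirchANT1999, Ch. II §5 Prop. (5.3)] -/
private theorem exists_unitPart :
    ∃ υ : (w.adicCompletion E)ˣ →* (w.adicCompletionIntegers E).unitGroup,
      ∀ x : (w.adicCompletion E)ˣ, Valued.v (x : w.adicCompletion E) = 1 →
        ((υ x : (w.adicCompletionIntegers E).unitGroup) : (w.adicCompletion E)ˣ) = x := by
  set ϖ : (w.adicCompletion E)ˣ := HeckeCharacter.uniformizer E w with hϖdef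
  have hϖ : Valued.v (ϖ : w.adicCompletion E) = WithZero.exp (-1 : ℤ) := HeckeCharacter.valued_uniformizer w
  have hne : ∀ x : (w.adicCompletion E)ˣ, Valued.v (x : w.adicCompletion E) ≠ 0 := fun x =>
    (Valuation.ne_zero_iff _).2 x.ne_zero
  let f : (w.adicCompletion E)ˣ →* (w.adicCompletion E)ˣ :=
    { toFun := fun x => x * ϖ ^ WithZero.log (Valued.v (x : w.adicCompletion E))
      map_one' := by rw [Units.val_one, map_one, WithZero.log_one, zpow_zero, one_mul]
      map_mul' := fun x y => by
        rw [Units.val_mul, map_mul, WithZero.log_mul (hne x) (hne y), zpow_add, mul_mul_mul_comm] }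
  have hf : ∀ x, Valued.v ((f x : (w.adicCompletion E)ˣ) : w.adicCompletion E) = 1 := by
    intro x
    change Valued.v (((x * ϖ ^ WithZero.log (Valued.v (x : w.adicCompletion E)) : (w.adicCompletion E)ˣ)) :
      w.adicCompletion E) = 1
    obtain ⟨m, hm⟩ : ∃ m : ℤ, Valued.v (x : w.adicCompletion E) = WithZero.exp m :=
      ⟨_, (WithZero.exp_log (hne x)).symm⟩
    rw [Units.val_mul, Units.val_zpow_eq_zpow_val, map_mul, map_zpow₀, hϖ, ← WithZero.exp_zsmul, smul_eq_mul,
      mul_neg, mul_one, hm, WithZero.log_exp, ← WithZero.exp_add, add_neg_cancel, WithZero.exp_zero]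
  refine ⟨MonoidHom.codRestrict f _ fun x => (Valuation.mem_unitGroup_iff _ Valued.v (f x)).2 (hf x), fun x hx => ?_⟩
  rw [MonoidHom.codRestrict_apply]
  change x * ϖ ^ WithZero.log (Valued.v (x : w.adicCompletion E)) = x
  rw [hx, WithZero.log_one, zpow_zero, mul_one]

/-- `−1 ≠ 1` in the residue field `κ(w)` of `𝒪_w` at a place `w ∤ 2` (`κ(w) = 𝓞 E ⧸ w`, tree `residue_algebraMap_eq_zero_iff`).
[cite: NeukirchANT1999, Ch. II §5 Prop. (5.3)] -/
private theorem neg_one_ne_one_residueField (h2 : (2 : 𝓞 E) ∉ w.asIdeal) :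
    (-1 : IsLocalRing.ResidueField (w.adicCompletionIntegers E)) ≠ 1 := by
  intro h
  have h0 : (2 : IsLocalRing.ResidueField (w.adicCompletionIntegers E)) = 0 := by
    rw [show (2 : IsLocalRing.ResidueField (w.adicCompletionIntegers E)) = 1 + 1 by norm_num]
    nth_rw 2 [← h]
    rw [add_neg_cancel]
  have key := (HeightOneSpectrum.residue_algebraMap_eq_zero_iff E w (2 : 𝓞 E)).1 (by
    rw [map_ofNat, map_ofNat]; exact h0)
  exact h2 key

/-- **a TAME character of `E_wˣ` at a place `w ∤ 2`**: a homomorphism `θ_w : E_wˣ → ℂˣ` with OPEN KERNEL, of FINITE ORDER,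
unitary, trivial on the principal units `{x : v_w(x − 1) < 1} = 1 + 𝔭_w`, and with `θ_w(−1) ≠ 1`.  It is `φ ∘ (𝒪_wˣ → κ(w)ˣ) ∘ (unit part)`
for a character `φ` of the finite group `κ(w)ˣ` with `φ(−1) ≠ 1` (`−1 ≠ 1` in `κ(w)` as `w ∤ 2`; characters of a finite abelian group
separate points) — a character of the factor `μ_{q−1} ≅ κ(w)ˣ` of `E_wˣ = (ϖ_w) × μ_{q−1} × U^{(1)}`. [cite: NeukirchANT1999, Ch. II §5 Prop. (5.3)] -/
theorem exists_tame_character (h2 : (2 : 𝓞 E) ∉ w.asIdeal) :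
    ∃ θ : (w.adicCompletion E)ˣ →* ℂˣ,
      IsOpen (θ.ker : Set (w.adicCompletion E)ˣ) ∧ IsOfFinOrder θ ∧ (∀ x, ‖((θ x : ℂˣ) : ℂ)‖ = 1) ∧
      (∀ x : (w.adicCompletion E)ˣ, Valued.v ((x : w.adicCompletion E) - 1) < 1 → θ x = 1) ∧ θ (-1) ≠ 1 := by
  classical
  obtain ⟨υ, hυ⟩ := exists_unitPart w
  have hm1 : (-1 : (IsLocalRing.ResidueField (w.adicCompletionIntegers E))ˣ) ≠ 1 := by
    intro h
    have h' := Units.ext_iff.1 h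
    rw [Units.val_neg, Units.val_one] at h'
    exact neg_one_ne_one_residueField w h2 h'
  obtain ⟨φ, hφ⟩ := CommGroup.exists_apply_ne_one_of_hasEnoughRootsOfUnity
    (IsLocalRing.ResidueField (w.adicCompletionIntegers E))ˣ ℂ hm1
  set r := (w.adicCompletionIntegers E).unitGroupToResidueFieldUnits with hr
  set n : ℕ := Nat.card (IsLocalRing.ResidueField (w.adicCompletionIntegers E))ˣ with hn
  have hn0 : 0 < n := Nat.card_pos
  have hφpow : ∀ g, φ g ^ n = 1 := fun g => by rw [← map_pow, pow_card_eq_one', map_one]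
  have hφnorm : ∀ g, ‖((φ g : ℂˣ) : ℂ)‖ = 1 := fun g => by
    have h1 : ‖((φ g : ℂˣ) : ℂ)‖ ^ n = 1 := by
      rw [← norm_pow, ← Units.val_pow_eq_pow_val, hφpow, Units.val_one, norm_one]
    exact (pow_eq_one_iff_of_nonneg (norm_nonneg _) hn0.ne').1 h1
  -- the character is trivial on the principal units
  have hprin : ∀ x : (w.adicCompletion E)ˣ, Valued.v ((x : w.adicCompletion E) - 1) < 1 → (φ.comp (r.comp υ)) x = 1 := by
    intro x hx
    have hvx : Valued.v (x : w.adicCompletion E) = 1 := by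
      have := Valuation.map_one_add_of_lt Valued.v hx
      rwa [add_sub_cancel] at this
    have hmemx : x ∈ (w.adicCompletionIntegers E).unitGroup := (Valuation.mem_unitGroup_iff _ Valued.v _).2 hvx
    have hυx : υ x = ⟨x, hmemx⟩ := Subtype.ext (hυ _ hvx)
    have hrx : r (υ x) = 1 := by
      rw [hυx, ← MonoidHom.mem_ker, hr, ValuationSubring.ker_unitGroupToResidueFieldUnits, Subgroup.mem_comap]
      change x ∈ (w.adicCompletionIntegers E).principalUnitGroup
      rw [ValuationSubring.mem_principalUnitGroup_iff]
      exact ((Valuation.isEquiv_valuation_valuationSubring Valued.v).lt_one_iff_lt_one).1 hx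
    rw [MonoidHom.comp_apply, MonoidHom.comp_apply, hrx, map_one]
  -- the character
  refine ⟨φ.comp (r.comp υ), ?_, ?_, fun x => hφnorm _, hprin, ?_⟩
  · -- open kernel
    refine Subgroup.isOpen_of_mem_nhds _ (g := 1) ?_
    have hU : {y : w.adicCompletion E | Valued.v (y - 1) < 1} ∈ nhds (1 : w.adicCompletion E) := by
      rw [Valued.mem_nhds]
      exact ⟨1, fun y hy => by simpa only [Set.mem_setOf_eq, Units.val_one, Valuation.restrict_lt_one_iff] using hy⟩
    have hU' : (Units.val ⁻¹' {y : w.adicCompletion E | Valued.v (y - 1) < 1}) ∈ nhds (1 : (w.adicCompletion E)ˣ) :=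
      Units.continuous_val.continuousAt.preimage_mem_nhds (by rw [Units.val_one]; exact hU)
    exact Filter.mem_of_superset hU' fun x hx => hprin x hx
  · -- finite order
    refine isOfFinOrder_iff_pow_eq_one.2 ⟨n, hn0, MonoidHom.ext fun x => ?_⟩
    rw [MonoidHom.pow_apply, MonoidHom.one_apply, MonoidHom.comp_apply, hφpow]
  · -- θ(-1) ≠ 1
    have hv1 : Valued.v (((-1 : (w.adicCompletion E)ˣ)) : w.adicCompletion E) = 1 := by
      rw [Units.val_neg, Units.val_one, Valuation.map_neg, Valuation.map_one]
    have hmem : (-1 : (w.adicCompletion E)ˣ) ∈ (w.adicCompletionIntegers E).unitGroup :=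
      (Valuation.mem_unitGroup_iff _ Valued.v _).2 hv1
    have hυ1 : υ (-1) = ⟨-1, hmem⟩ := Subtype.ext (hυ _ hv1)
    have hr1 : r (υ (-1)) = -1 := by
      rw [hυ1]
      apply Units.ext
      rw [hr, ValuationSubring.coe_unitGroupToResidueFieldUnits_apply]
      conv_rhs => rw [Units.val_neg, Units.val_one]
      have : ((w.adicCompletionIntegers E).unitGroupMulEquiv ⟨-1, hmem⟩ : w.adicCompletionIntegers E) = -1 :=
        Subtype.ext (by rw [ValuationSubring.coe_unitGroupMulEquiv_apply]; rfl)
      rw [this, map_neg, map_one]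
      rfl
    rw [MonoidHom.comp_apply, MonoidHom.comp_apply, hr1]
    exact hφ

/-- A homomorphism with open kernel is locally constant (copy of the tree's private lemma in
`CharacterPrescribedLocalComponentsProofs`). [folklore] -/
private theorem isLocallyConstant_of_isOpen_ker {Γ G : Type*} [Group Γ] [TopologicalSpace Γ]
    [ContinuousMul Γ] [Group G] (r : Γ →* G) (h : IsOpen (r.ker : Set Γ)) :
    IsLocallyConstant r := by
  refine (IsLocallyConstant.iff_exists_open r).2 fun σ => ⟨{τ | σ⁻¹ * τ ∈ r.ker}, ?_, ?_, ?_⟩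
  · exact h.preimage (continuous_const_mul σ⁻¹)
  · show σ⁻¹ * σ ∈ r.ker
    rw [inv_mul_cancel]; exact r.ker.one_mem
  · intro τ hτ
    have hτ' : r (σ⁻¹ * τ) = 1 := hτ
    rw [map_mul, map_inv, inv_mul_eq_one] at hτ'
    exact hτ'.symm

/-- a character of `E_wˣ` with open kernel is continuous (as a `ℂ`-valued function). [folklore] -/
private theorem continuous_of_isOpen_ker (θ : (w.adicCompletion E)ˣ →* ℂˣ) (h : IsOpen (θ.ker : Set (w.adicCompletion E)ˣ)) :
    Continuous fun x => ((θ x : ℂˣ) : ℂ) :=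
  Units.continuous_val.comp (isLocallyConstant_of_isOpen_ker θ h).continuous

end Local

/-! ## §2 The place model of a quadratic extension `E/F`: the tame twist `χ = θ_w((x / (c ⊗ 1) x)_w)` -/

section PlaceModel

open UnitaryGroup

variable {F : Type} (E : Type) [Field F] [NumberField F] [Field E] [NumberField E] [Algebra F E]
  [Algebra.IsQuadraticExtension F E] (v : HeightOneSpectrum (𝓞 F)) (c : E ≃ₐ[F] E)
  {δ : E} (hcδ : c δ = -δ) (hδ : δ ≠ 0)

omit [Algebra.IsQuadraticExtension F E] in
include hcδ in
/-- **the tame twisting character of the place model**: at a place `w ∣ v` of `E` not above `2` there is a character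
`χ : E_vˣ → ℂˣ` — `θ_w` (§1) of the `w`-component of `x · ((c ⊗ 1) x)⁻¹` — which is unitary, continuous, of finite order, TRIVIAL on
every `(c ⊗ 1)`-fixed unit (in particular on `ι_v(F_vˣ)`, `conjLocal_toLocalRing`), and takes the value `θ_w(−1) = −1` at Step 1's
representative `ε = δ ⊗ 1` (`(c ⊗ 1) ε = −ε`, so `ε · ((c ⊗ 1) ε)⁻¹ = −1`; `θ_w(−1)² = 1 ≠ θ_w(−1)`).
[cite: Liu2021, App. D §D.1 Steps 1–2 (l. 5217–5219)] [cite: NeukirchANT1999, Ch. II §5 Prop. (5.3)] -/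
theorem exists_twistChar (w : PlacesOver E v) (h2 : (2 : 𝓞 E) ∉ w.1.asIdeal) :
    ∃ χ : (LocalRing E v)ˣ →* ℂˣ,
      (∀ x, ‖((χ x : ℂˣ) : ℂ)‖ = 1) ∧ (Continuous fun x => ((χ x : ℂˣ) : ℂ)) ∧ IsOfFinOrder χ ∧
      (∀ x : (LocalRing E v)ˣ, conjLocal E c v x = x → χ x = 1) ∧
      (∀ a : (v.adicCompletion F)ˣ, χ (Units.map (algebraMap (v.adicCompletion F) (LocalRing E v)).toMonoidHom a) = 1) ∧
      χ (LemD1OfPlace.eps E v hδ) = -1 := by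
  obtain ⟨θ, hθopen, hθfin, hθnorm, -, hθneg⟩ := exists_tame_character w.1 h2
  -- `ρ x = x · ((c ⊗ 1) x)⁻¹`, `pr_w`, and `χ = θ ∘ pr_w ∘ ρ`
  let cu : (LocalRing E v)ˣ →* (LocalRing E v)ˣ := Units.map (conjLocal E c v).toMonoidHom
  let ρ : (LocalRing E v)ˣ →* (LocalRing E v)ˣ := (MonoidHom.id _) / cu
  have hρ : ∀ x, ρ x = x * (cu x)⁻¹ := fun x => by
    rw [MonoidHom.div_apply, MonoidHom.id_apply, div_eq_mul_inv]
  let prw : (LocalRing E v)ˣ →* (w.1.adicCompletion E)ˣ :=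
    Units.map (Pi.evalRingHom (fun w' : PlacesOver E v => w'.1.adicCompletion E) w).toMonoidHom
  have hprw : ∀ y : (LocalRing E v)ˣ, ((prw y : (w.1.adicCompletion E)ˣ) : w.1.adicCompletion E) = (y : LocalRing E v) w :=
    fun y => rfl
  have hθsq : θ (-1) = -1 := by
    have h1 : θ (-1) ^ 2 = 1 := by rw [← map_pow, neg_one_sq, map_one]
    have h2' : (((θ (-1) : ℂˣ) : ℂ)) ^ 2 = 1 := by rw [← Units.val_pow_eq_pow_val, h1, Units.val_one]
    rcases sq_eq_one_iff.1 h2' with h | h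
    · exact absurd (Units.ext h) hθneg
    · exact Units.ext (by rw [h, Units.val_neg, Units.val_one])
  refine ⟨θ.comp (prw.comp ρ), fun x => hθnorm _, ?_, ?_, ?_, ?_, ?_⟩
  · -- continuity
    have hρc : Continuous ρ := by
      have : (ρ : (LocalRing E v)ˣ → (LocalRing E v)ˣ) = fun x => x * (cu x)⁻¹ := funext hρ
      rw [this]
      exact continuous_id.mul ((Continuous.units_map _ (continuous_conjLocal E c v)).inv)
    exact (continuous_of_isOpen_ker w.1 θ hθopen).comp ((Continuous.units_map _ (continuous_apply w)).comp hρc)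
  · -- finite order
    obtain ⟨n, hn, hθn⟩ := hθfin.exists_pow_eq_one
    refine isOfFinOrder_iff_pow_eq_one.2 ⟨n, hn, MonoidHom.ext fun x => ?_⟩
    rw [MonoidHom.pow_apply, MonoidHom.one_apply, MonoidHom.comp_apply, ← MonoidHom.pow_apply, hθn, MonoidHom.one_apply]
  · -- trivial on `(c ⊗ 1)`-fixed units
    intro x hx
    have hcu : cu x = x := Units.ext hx
    rw [MonoidHom.comp_apply, MonoidHom.comp_apply, hρ, hcu, mul_inv_cancel, map_one, map_one]
  · -- trivial on `ι_v(F_vˣ)`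
    intro a
    have hcu : cu (Units.map (algebraMap (v.adicCompletion F) (LocalRing E v)).toMonoidHom a) =
        Units.map (algebraMap (v.adicCompletion F) (LocalRing E v)).toMonoidHom a :=
      Units.ext (by
        change conjLocal E c v (algebraMap (v.adicCompletion F) (LocalRing E v) a) = algebraMap (v.adicCompletion F) (LocalRing E v) a
        rw [algebraMap_localRing_eq, conjLocal_toLocalRing])
    rw [MonoidHom.comp_apply, MonoidHom.comp_apply, hρ, hcu, mul_inv_cancel, map_one, map_one]
  · -- value at `ε = δ ⊗ 1`
    have hcu : cu (LemD1OfPlace.eps E v hδ) = -LemD1OfPlace.eps E v hδ :=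
      Units.ext (by
        change conjLocal E c v (algebraMap E (LocalRing E v) δ) = -algebraMap E (LocalRing E v) δ
        rw [conjLocal_algebraMap, hcδ, map_neg])
    have hρe : ρ (LemD1OfPlace.eps E v hδ) = -1 := by
      rw [hρ, hcu, inv_neg, mul_neg, mul_inv_cancel]
    have hpr : prw (-1) = -1 := Units.ext rfl
    rw [MonoidHom.comp_apply, MonoidHom.comp_apply, hρe, hpr, hθsq]

omit [NumberField F] [NumberField E] [Algebra.IsQuadraticExtension F E] in
/-- a place of `E` above a place `v ∤ 2` of `F` does not lie above `2` (`v = w ∩ 𝓞 F`). [cite: NeukirchANT1999, Ch. I §8] -/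
theorem two_not_mem_of_placesOver (w : PlacesOver E v) (h2 : (2 : 𝓞 F) ∉ v.asIdeal) : (2 : 𝓞 E) ∉ w.1.asIdeal := by
  intro h
  apply h2
  have hv : v.asIdeal = (w.1.asIdeal).under (𝓞 F) := by rw [← HeightOneSpectrum.under_asIdeal, w.2]
  rw [hv, Ideal.under_def, Ideal.mem_comap, map_ofNat]
  exact h

/-! ## §3 The twist: a SECOND Step-2 datum `μ · χ` next to any Step-2 datum `μ`, at every place `∤ 2` -/

omit [Algebra.IsQuadraticExtension F E] in
/-- **the printed Step-2 clause is stable under twisting by a character trivial on `ι_v(F_vˣ)`**: if «`μ(ι_v a) = 1 ↔ a ∈ Nm E_vˣ`»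
and `χ(ι_v a) = 1` for all `a ∈ F_vˣ`, then «`(μ · χ)(ι_v a) = 1 ↔ a ∈ Nm E_vˣ`» (the clause only constrains `μ|_{F_vˣ}`).
[cite: Liu2021, App. D §D.1 Step 2 (l. 5219)] -/
theorem stepTwo_clause_mul (μ χ : (LocalRing E v)ˣ →* ℂˣ)
    (hμF : ∀ a : (v.adicCompletion F)ˣ,
      μ (Units.map (algebraMap (v.adicCompletion F) (LocalRing E v)).toMonoidHom a) = 1 ↔
        ∃ x : (LocalRing E v)ˣ, (x : LocalRing E v) * conjLocal E c v x =
          algebraMap (v.adicCompletion F) (LocalRing E v) a)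
    (hχF : ∀ a : (v.adicCompletion F)ˣ, χ (Units.map (algebraMap (v.adicCompletion F) (LocalRing E v)).toMonoidHom a) = 1)
    (a : (v.adicCompletion F)ˣ) :
    (μ * χ) (Units.map (algebraMap (v.adicCompletion F) (LocalRing E v)).toMonoidHom a) = 1 ↔
      ∃ x : (LocalRing E v)ˣ, (x : LocalRing E v) * conjLocal E c v x =
        algebraMap (v.adicCompletion F) (LocalRing E v) a := by
  rw [MonoidHom.mul_apply, hχF a, mul_one]
  exact hμF a

omit [Algebra.IsQuadraticExtension F E] in
include hcδ in
/-- **a SECOND Step-2 datum at every place `w ∤ 2`** (split, inert or ramified): for every Step-2 datum `μ` of the place model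
(displayed binder shape: unitary, continuous, the printed clause «`μ(ι_v a) = 1 ↔ a ∈ Nm E_vˣ`») there is a Step-2 datum `μ'` with
`μ'(ε) = −μ(ε)` at `ε = δ ⊗ 1` — so `μ' ≠ μ` —, agreeing with `μ` on the `(c ⊗ 1)`-fixed units, and `μ' = μ · χ` for a character `χ` of
finite order (the tame twist of §2). [cite: Liu2021, App. D §D.1 Step 2 (l. 5219)] [cite: NeukirchANT1999, Ch. II §5 Prop. (5.3)] -/
theorem exists_stepTwo_twist (w : PlacesOver E v) (h2 : (2 : 𝓞 E) ∉ w.1.asIdeal)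
    (μ : (LocalRing E v)ˣ →* ℂˣ) (hμn : ∀ x, ‖((μ x : ℂˣ) : ℂ)‖ = 1) (hμc : Continuous fun x => ((μ x : ℂˣ) : ℂ))
    (hμF : ∀ a : (v.adicCompletion F)ˣ,
      μ (Units.map (algebraMap (v.adicCompletion F) (LocalRing E v)).toMonoidHom a) = 1 ↔
        ∃ x : (LocalRing E v)ˣ, (x : LocalRing E v) * conjLocal E c v x =
          algebraMap (v.adicCompletion F) (LocalRing E v) a) :
    ∃ (μ' : (LocalRing E v)ˣ →* ℂˣ) (_ : ∀ x, ‖((μ' x : ℂˣ) : ℂ)‖ = 1) (_ : Continuous fun x => ((μ' x : ℂˣ) : ℂ))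
      (_ : ∀ a : (v.adicCompletion F)ˣ,
        μ' (Units.map (algebraMap (v.adicCompletion F) (LocalRing E v)).toMonoidHom a) = 1 ↔
          ∃ x : (LocalRing E v)ˣ, (x : LocalRing E v) * conjLocal E c v x =
            algebraMap (v.adicCompletion F) (LocalRing E v) a),
      μ' (LemD1OfPlace.eps E v hδ) = -μ (LemD1OfPlace.eps E v hδ) ∧ μ' ≠ μ ∧
      (∀ x : (LocalRing E v)ˣ, conjLocal E c v x = x → μ' x = μ x) ∧
      ∃ χ : (LocalRing E v)ˣ →* ℂˣ, IsOfFinOrder χ ∧ μ' = μ * χ := by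
  obtain ⟨χ, hχn, hχc, hχfin, hχfix, hχF, hχe⟩ := exists_twistChar E v c hcδ hδ w h2
  refine ⟨μ * χ, fun x => ?_, ?_, stepTwo_clause_mul E v c μ χ hμF hχF, ?_, ?_, fun x hx => ?_, χ, hχfin, rfl⟩
  · rw [MonoidHom.mul_apply, Units.val_mul, norm_mul, hμn, hχn, mul_one]
  · have : (fun x => (((μ * χ) x : ℂˣ) : ℂ)) = fun x => ((μ x : ℂˣ) : ℂ) * ((χ x : ℂˣ) : ℂ) :=
      funext fun x => by rw [MonoidHom.mul_apply, Units.val_mul]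
    rw [this]
    exact hμc.mul hχc
  · rw [MonoidHom.mul_apply, hχe, mul_neg, mul_one]
  · intro h
    have h1 := DFunLike.congr_fun h (LemD1OfPlace.eps E v hδ)
    rw [MonoidHom.mul_apply, hχe, mul_neg, mul_one] at h1
    have h2' := Units.ext_iff.1 h1
    rw [Units.val_neg] at h2'
    have h3 : (((μ (LemD1OfPlace.eps E v hδ)) : ℂˣ) : ℂ) = 0 := by linear_combination (-1 : ℂ) / 2 * h2'
    exact (μ (LemD1OfPlace.eps E v hδ)).ne_zero h3
  · rw [MonoidHom.mul_apply, hχfix x hx, mul_one]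

variable (N : ℕ) (J : Matrix (Fin N) (Fin N) E) (hN : 2 ≤ N) (hJh : (J.map c)ᵀ = J) (hJdet : J.det ≠ 0)

include hcδ in
/-- **`MuSet` form**: next to every element `μ` of the printed Step-2 index set `LemD1.MuSet (LemD1OfPlace.standingData …)` of the place
model there is a DIFFERENT element `μ'`, `μ'(ε) = −μ(ε)`, agreeing with `μ` on the `(c ⊗ 1)`-fixed units — at every place `w ∤ 2` (split or
not). [cite: Liu2021, App. D §D.1 Step 2 (l. 5219)] -/
theorem exists_muSet_ne_twist (w : PlacesOver E v) (h2 : (2 : 𝓞 E) ∉ w.1.asIdeal)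
    (μ : LemD1.MuSet (LemD1OfPlace.standingData E v c N J hcδ hδ hN hJh hJdet)) :
    ∃ μ' : LemD1.MuSet (LemD1OfPlace.standingData E v c N J hcδ hδ hN hJh hJdet),
      μ' ≠ μ ∧ μ'.1 (LemD1OfPlace.eps E v hδ) = -μ.1 (LemD1OfPlace.eps E v hδ) ∧
      ∀ x : (LocalRing E v)ˣ, conjLocal E c v x = x → μ'.1 x = μ.1 x := by
  obtain ⟨μ', hμ'n, hμ'c, hμ'F, he, hne, hfix, -⟩ := exists_stepTwo_twist E v c hcδ hδ w h2 μ.1 μ.2.1 μ.2.2.1 μ.2.2.2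
  exact ⟨LemD1OfPlace.muOf E v c N J hcδ hδ hN hJh hJdet μ' hμ'n hμ'c hμ'F, fun h => hne (congrArg Subtype.val h), he, hfix⟩

include hcδ in
/-- **… packaged through `LemD1OfPlace.muOf`** (the rows' own packaging, with the displayed proof shapes): `muOf μ' ≠ muOf μ`,
`μ'(ε) = −μ(ε)`. [cite: Liu2021, App. D §D.1 Step 2 (l. 5219)] -/
theorem exists_muOf_ne_twist (w : PlacesOver E v) (h2 : (2 : 𝓞 E) ∉ w.1.asIdeal)
    (μ : (LocalRing E v)ˣ →* ℂˣ) (hμn : ∀ x, ‖((μ x : ℂˣ) : ℂ)‖ = 1) (hμc : Continuous fun x => ((μ x : ℂˣ) : ℂ))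
    (hμF : ∀ a : (v.adicCompletion F)ˣ,
      μ (Units.map (algebraMap (v.adicCompletion F) (LocalRing E v)).toMonoidHom a) = 1 ↔
        ∃ x : (LocalRing E v)ˣ, (x : LocalRing E v) * conjLocal E c v x =
          algebraMap (v.adicCompletion F) (LocalRing E v) a) :
    ∃ (μ' : (LocalRing E v)ˣ →* ℂˣ) (hμ'n : ∀ x, ‖((μ' x : ℂˣ) : ℂ)‖ = 1) (hμ'c : Continuous fun x => ((μ' x : ℂˣ) : ℂ))
      (hμ'F : ∀ a : (v.adicCompletion F)ˣ,
        μ' (Units.map (algebraMap (v.adicCompletion F) (LocalRing E v)).toMonoidHom a) = 1 ↔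
          ∃ x : (LocalRing E v)ˣ, (x : LocalRing E v) * conjLocal E c v x =
            algebraMap (v.adicCompletion F) (LocalRing E v) a),
      μ' (LemD1OfPlace.eps E v hδ) = -μ (LemD1OfPlace.eps E v hδ) ∧
      LemD1OfPlace.muOf E v c N J hcδ hδ hN hJh hJdet μ' hμ'n hμ'c hμ'F ≠
        LemD1OfPlace.muOf E v c N J hcδ hδ hN hJh hJdet μ hμn hμc hμF := by
  obtain ⟨μ', hμ'n, hμ'c, hμ'F, he, hne, -, -⟩ := exists_stepTwo_twist E v c hcδ hδ w h2 μ hμn hμc hμF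
  exact ⟨μ', hμ'n, hμ'c, hμ'F, he, fun h => hne (congrArg Subtype.val h)⟩

omit [Algebra.IsQuadraticExtension F E] in
/-- the `w`-component of `x · (ι_v π)^m` has valuation `1` when `v_w(x_w) = exp(m)` and `v_w(ι_w π) = exp(−1)` (copy of the private
lemma of `LemD1IndexedNonVacuityInertRigidity`). [cite: CasselsFrohlichANT1967, Ch. II §10] -/
private theorem valued_mul_zpow_apply_eq_one (w : PlacesOver E v) (π : (v.adicCompletion F)ˣ)
    (hπ : Valued.v (toPlace v w (π : v.adicCompletion F)) = WithZero.exp (-1 : ℤ)) (x : (LocalRing E v)ˣ) :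
    Valued.v (((x * Units.map (algebraMap (v.adicCompletion F) (LocalRing E v)).toMonoidHom π ^
        WithZero.log (Valued.v ((x : LocalRing E v) w)) : (LocalRing E v)ˣ) : LocalRing E v) w) = 1 := by
  set m : ℤ := WithZero.log (Valued.v ((x : LocalRing E v) w)) with hm
  let prw : (LocalRing E v)ˣ →* (w.1.adicCompletion E)ˣ :=
    Units.map (Pi.evalRingHom (fun w' : PlacesOver E v => w'.1.adicCompletion E) w).toMonoidHom
  have hprw : ∀ y : (LocalRing E v)ˣ, ((prw y : (w.1.adicCompletion E)ˣ) : w.1.adicCompletion E) = (y : LocalRing E v) w :=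
    fun y => rfl
  have hx0 : Valued.v ((x : LocalRing E v) w) ≠ 0 := by
    rw [← hprw]
    exact (Valuation.ne_zero_iff _).2 (prw x).ne_zero
  have hP : Valued.v ((prw (Units.map (algebraMap (v.adicCompletion F) (LocalRing E v)).toMonoidHom π) :
      (w.1.adicCompletion E)ˣ) : w.1.adicCompletion E) = WithZero.exp (-1 : ℤ) := by
    rw [hprw, Units.coe_map, RingHom.toMonoidHom_eq_coe, MonoidHom.coe_coe, algebraMap_localRing_eq, toLocalRing_apply, hπ]
  rw [← hprw, map_mul, map_zpow, Units.val_mul, Units.val_zpow_eq_zpow_val, map_mul, map_zpow₀, hP, ← WithZero.exp_zsmul,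
    hprw, ← WithZero.exp_log hx0, ← hm, ← WithZero.exp_add, smul_eq_mul, mul_neg, mul_one, add_neg_cancel, WithZero.exp_zero]

omit [Algebra.IsQuadraticExtension F E] in
include hcδ hδ in
/-- **a RAMIFIED companion at a place with an inert witness**: at a place `w ∣ v`, `w ∤ 2`, with `π ∈ F_vˣ` of `w`-valuation
`exp(−1)` (so at every place INERT in `E`: a uniformiser of `F_v` stays one of `E_w`), next to every Step-2 datum `μ` there is a
Step-2 datum `μ'` (namely `μ` itself or its tame twist `μ · χ`) which is NOT unramified: `μ'(u) ≠ 1` at a unit `u ∈ E_vˣ` of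
`w`-valuation `1` (`u = ε · (ι_v π)^m` with `exp(m) = v_w(ε_w)`; `χ(u) = χ(ε) = −1` as `ι_v π` is `(c ⊗ 1)`-fixed).  With
`LemD1IndexedNonVacuityInertRigidity` (the unramified Step-2 datum at an inert place is unique) and `…RamifiedPlace` §4 (at a ramified place
every Step-2 datum is ramified): at every NON-SPLIT place of odd residue characteristic carrying a Step-2 datum there is a RAMIFIED one.
[cite: Liu2021, App. D §D.1 Step 2 (l. 5219)] [cite: CasselsFrohlichANT1967, Ch. II §10] -/
theorem exists_stepTwo_apply_unit_ne_one (w : PlacesOver E v) (h2 : (2 : 𝓞 E) ∉ w.1.asIdeal) (π : (v.adicCompletion F)ˣ)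
    (hπ : Valued.v (toPlace v w (π : v.adicCompletion F)) = WithZero.exp (-1 : ℤ))
    (μ : (LocalRing E v)ˣ →* ℂˣ) (hμn : ∀ x, ‖((μ x : ℂˣ) : ℂ)‖ = 1) (hμc : Continuous fun x => ((μ x : ℂˣ) : ℂ))
    (hμF : ∀ a : (v.adicCompletion F)ˣ,
      μ (Units.map (algebraMap (v.adicCompletion F) (LocalRing E v)).toMonoidHom a) = 1 ↔
        ∃ x : (LocalRing E v)ˣ, (x : LocalRing E v) * conjLocal E c v x =
          algebraMap (v.adicCompletion F) (LocalRing E v) a) :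
    ∃ (μ' : (LocalRing E v)ˣ →* ℂˣ) (_ : ∀ x, ‖((μ' x : ℂˣ) : ℂ)‖ = 1) (_ : Continuous fun x => ((μ' x : ℂˣ) : ℂ))
      (_ : ∀ a : (v.adicCompletion F)ˣ,
        μ' (Units.map (algebraMap (v.adicCompletion F) (LocalRing E v)).toMonoidHom a) = 1 ↔
          ∃ x : (LocalRing E v)ˣ, (x : LocalRing E v) * conjLocal E c v x =
            algebraMap (v.adicCompletion F) (LocalRing E v) a),
      ∃ u : (LocalRing E v)ˣ, Valued.v ((u : LocalRing E v) w) = 1 ∧ μ' u ≠ 1 := by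
  set P : (LocalRing E v)ˣ := Units.map (algebraMap (v.adicCompletion F) (LocalRing E v)).toMonoidHom π with hP
  set u : (LocalRing E v)ˣ := LemD1OfPlace.eps E v hδ * P ^ WithZero.log (Valued.v ((LemD1OfPlace.eps E v hδ : LocalRing E v) w))
    with hu
  have hu1 : Valued.v ((u : LocalRing E v) w) = 1 := valued_mul_zpow_apply_eq_one E v w π hπ _
  by_cases hμu : μ u = 1
  · obtain ⟨μ', hμ'n, hμ'c, hμ'F, he, -, hfix, -⟩ := exists_stepTwo_twist E v c hcδ hδ w h2 μ hμn hμc hμF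
    have hPfix : conjLocal E c v P = P := by
      rw [hP, Units.coe_map, RingHom.toMonoidHom_eq_coe, MonoidHom.coe_coe, algebraMap_localRing_eq, conjLocal_toLocalRing]
    have hPm : ∀ m : ℤ, μ' (P ^ m) = μ (P ^ m) := fun m => by
      rw [map_zpow, map_zpow, hfix P hPfix]
    refine ⟨μ', hμ'n, hμ'c, hμ'F, u, hu1, ?_⟩
    rw [hu, map_mul, he, hPm, neg_mul, ← map_mul, ← hu, hμu]
    exact fun h => by
      have := Units.ext_iff.1 h
      rw [Units.val_neg, Units.val_one] at this
      norm_num at this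
  · exact ⟨μ, hμn, hμc, hμF, u, hu1, hμu⟩

/-! ## §4 The μ-teeth of [Lem. D.1 (3)] AS PRINTED bite at every place `∤ 2` carrying a Step-2 datum -/

/-- **Item (1) AS PRINTED holds at a character datum of rank `n ≠ 2`** (both sides of (1) false, the right one through its
conjunct «(in particular `n = 2`)»; the maximal `χ`-quotient is the line: irreducible, admissible, non-zero).  Private twin of
`LemD1IndexedNonVacuityNonsplit.lemD1_1AsPrinted_of_character_of_rank_ne_two` (kept private, as in `LemD1IndexedNonVacuityAtPlace` and
`…NonsplitPlace`, to keep this file's import closure free of the `ℚ₃(i)` leaf). [cite: Liu2021, App. D Lemma D.1 (1) (l. 5229)] -/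
private theorem lemD1_1AsPrinted_of_character_of_rank_ne_two' {F₀ E₀ : Type} [Field F₀] [ValuativeRel F₀]
    [TopologicalSpace F₀] [CommRing E₀] [Algebra F₀ E₀] [TopologicalSpace E₀] [IsTopologicalRing E₀] {n₀ : ℕ}
    (L : LemD1Data F₀ E₀ n₀ ℂ) (lam : L.S.U →* ℂˣ) (hω : ∀ (g : L.S.U) (x : ℂ), L.omega g x = (lam g : ℂ) * x)
    (hcen : ∀ z : L.S.normOne, lam (L.S.scalar z) = L.chi z)
    (hopen : ∃ O : Set L.S.U, IsOpen O ∧ (1 : L.S.U) ∈ O ∧ ∀ g ∈ O, lam g = 1) (hn : n₀ ≠ 2) :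
    LemD1_1AsPrinted L := by
  have hN : augmentation L.omega L.S.scalar L.chi = ⊥ := by
    unfold augmentation
    refine iSup_eq_bot.2 fun z => ?_
    rw [LinearMap.range_eq_bot]
    ext
    simp [hω, hcen]
  have hfin : Module.finrank ℂ (ℂ ⧸ augmentation L.omega L.S.scalar L.chi) = 1 := by
    rw [(Submodule.quotEquivOfEqBot _ hN).finrank_eq, Module.finrank_self]
  haveI hsimple : IsSimpleModule ℂ (ℂ ⧸ augmentation L.omega L.S.scalar L.chi) :=
    isSimpleModule_iff_finrank_eq_one.2 hfin
  have hact : ∀ (g : L.S.U) (w : ℂ ⧸ augmentation L.omega L.S.scalar L.chi),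
      L.datum.quot g w = (lam g : ℂ) • w := by
    intro g w
    obtain ⟨y, rfl⟩ := Submodule.Quotient.mk_surjective _ w
    rw [LemD1Data.datum_quot, quotRep_mk, hω, ← smul_eq_mul, Submodule.Quotient.mk_smul]
  refine ⟨⟨?_, ?_, ?_⟩, ?_⟩
  · intro W
    rcases eq_bot_or_eq_top W.toSubmodule with h | h
    · exact Or.inl (Subrepresentation.toSubmodule_injective h)
    · exact Or.inr (Subrepresentation.toSubmodule_injective h)
  · intro x
    obtain ⟨O, hO, h1O, hlam⟩ := hopen
    change IsOpen (L.datum.quot.stabilizerSubgroup x : Set L.S.U)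
    refine Subgroup.isOpen_of_mem_nhds _ (g := 1) (Filter.mem_of_superset (hO.mem_nhds h1O) fun g hg => ?_)
    change L.datum.quot g x = x
    rw [hact, hlam g hg, Units.val_one, one_smul]
  · intro K _
    infer_instance
  · refine iff_of_false ?_ ?_
    · rw [not_subsingleton_iff_nontrivial]
      exact Module.nontrivial_of_finrank_pos (R := ℂ) (by rw [hfin]; exact one_pos)
    · exact fun h => hn h.2.1.2

include hcδ in
/-- **the μ-teeth of [Lem. D.1 (3)] AS PRINTED at EVERY place `w ∤ 2` carrying a Step-2 datum** (rank `N ≥ 3`): for every element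
`μ` of the printed Step-2 index set of the place model and every representative `e`, the two-member collection with labels `(μ, e, 1)`,
`(μ', e, 1)` — `μ'` the tame twist of §3, `μ'(ε) = −μ(ε)` — and BOTH carriers the trivial line satisfies (1) member by member (rank `≠ 2`)
but VIOLATES `LemD1_3AsPrintedI`: its two `ω`'s are isomorphic (equal) while `μ ≠ μ'`.  Previously in the tree only at SPLIT places
(`LemD1IndexedNonVacuityAtPlace` §6, §9) or under `∃ x, μ(x)² ≠ 1` (§8 there); here at every non-split place of odd residue characteristic too.
[cite: Liu2021, App. D Lemma D.1 (1) and (3) (l. 5229, 5233)] -/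
theorem exists_lemD1IndexedFamily_item1_not_lemD1_3_twist (w : PlacesOver E v) (h2 : (2 : 𝓞 E) ∉ w.1.asIdeal) (h3 : 3 ≤ N)
    (μ : LemD1.MuSet (LemD1OfPlace.standingData E v c N J hcδ hδ hN hJh hJdet))
    (e : LemD1.EpsRep (LemD1OfPlace.standingData E v c N J hcδ hδ hN hJh hJdet)) :
    ∃ Lf : LemD1IndexedFamily (v.adicCompletion F) (LocalRing E v) N (Fin 2),
      Lf.S = LemD1OfPlace.standingData E v c N J hcδ hδ hN hJh hJdet ∧
      (∀ i, (Lf.eps i).1 = e.1) ∧ (∀ i, (Lf.chi i).1 = 1) ∧ (Lf.mu 0).1 = μ.1 ∧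
      (Lf.mu 1).1 (LemD1OfPlace.eps E v hδ) = -μ.1 (LemD1OfPlace.eps E v hδ) ∧
      Lf.Item1AsPrinted ∧ Lf.mu 0 ≠ Lf.mu 1 ∧ ¬ LemD1_3AsPrintedI Lf := by
  classical
  obtain ⟨e₁, he₁⟩ := e
  have hN2 : N ≠ 2 := by omega
  obtain ⟨μ₁, hne, hμ₁, -⟩ := exists_muSet_ne_twist E v c hcδ hδ N J hN hJh hJdet w h2 μ
  let χ : LemD1.ChiSet (LemD1OfPlace.standingData E v c N J hcδ hδ hN hJh hJdet) :=
    ⟨1, fun z => by simp, by simpa using continuous_const⟩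
  let ω₀ : Representation ℂ (LemD1OfPlace.standingData E v c N J hcδ hδ hN hJh hJdet).U ℂ :=
    Representation.trivial ℂ _ ℂ
  have hω₀ : ∀ (g : (LemD1OfPlace.standingData E v c N J hcδ hδ hN hJh hJdet).U) (x : ℂ),
      ω₀ g x = ((1 : (LemD1OfPlace.standingData E v c N J hcδ hδ hN hJh hJdet).U →* ℂˣ) g : ℂ) * x := fun g x => by
    rw [MonoidHom.one_apply, Units.val_one, one_mul]; rfl
  let Lf : LemD1IndexedFamily (v.adicCompletion F) (LocalRing E v) N (Fin 2) :=
    { isNonarchimedeanLocalField := inferInstance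
      isModuleTopology := LemD1OfPlace.isModuleTopology_localRing E v
      S := LemD1OfPlace.standingData E v c N J hcδ hδ hN hJh hJdet
      mu := ![μ, μ₁]
      eps := fun _ => ⟨e₁, he₁⟩
      chi := fun _ => χ
      V := fun _ => ℂ
      omega := fun _ => ω₀ }
  have hμne : Lf.mu 0 ≠ Lf.mu 1 := fun h => hne h.symm
  have hItem1 : Lf.Item1AsPrinted := fun i =>
    lemD1_1AsPrinted_of_character_of_rank_ne_two' (Lf.single i) 1 hω₀ (fun z => rfl)
      ⟨Set.univ, isOpen_univ, Set.mem_univ _, fun g _ => rfl⟩ hN2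
  have hnot3 : ¬ LemD1_3AsPrintedI Lf := fun h =>
    hμne ((h h3 0 1).1 ⟨LinearEquiv.refl ℂ _, fun _ _ => rfl⟩).1.symm
  exact ⟨Lf, rfl, fun _ => rfl, fun _ => rfl, rfl, hμ₁, hItem1, hμne, hnot3⟩

include hcδ in
/-- **at every place `∤ 2` carrying a Step-2 datum, (3) AS PRINTED is not a consequence of (1)** on two-member collections over the
place model (rank `N ≥ 3`): the displayed record `LemD1_3AsPrintedI` REJECTS carriers that do not separate the two Step-2 labels `μ ≠ μ'`.
[cite: Liu2021, App. D Lemma D.1 (1) and (3) (l. 5229, 5233)] -/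
theorem not_forall_lemD1_3_of_item1_twist (w : PlacesOver E v) (h2 : (2 : 𝓞 E) ∉ w.1.asIdeal) (h3 : 3 ≤ N)
    (hμ : Nonempty (LemD1.MuSet (LemD1OfPlace.standingData E v c N J hcδ hδ hN hJh hJdet))) :
    ¬ ∀ Lf : LemD1IndexedFamily (v.adicCompletion F) (LocalRing E v) N (Fin 2),
        Lf.S = LemD1OfPlace.standingData E v c N J hcδ hδ hN hJh hJdet → Lf.Item1AsPrinted → LemD1_3AsPrintedI Lf := by
  obtain ⟨μ⟩ := hμ
  obtain ⟨Lf, hS, -, -, -, -, h1, -, h3'⟩ := exists_lemD1IndexedFamily_item1_not_lemD1_3_twist E v c hcδ hδ N J hN hJh hJdet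
    w h2 h3 μ (LemD1OfPlace.epsDelta E v c N J hcδ hδ hN hJh hJdet)
  exact fun h => h3' (h Lf hS h1)

end PlaceModel

/-! ## §5 The CM rows: the rows' OWN μ-slot `localMu L (toHeckeCharacter L ψ) v` has a tame companion at every place `v ∤ 2` of `L⁺` -/

section CM

open UnitaryGroup
open Literature.NumberTheory.GelbartRogawski1991.UnitaryDualPair (imagUnit complexConj_imagUnit imagUnit_ne_zero)
open Literature.NumberTheory.GelbartRogawski1991.UnitaryDualPair.LocalSplitting (localMu localMu_apply norm_localMu
  continuous_localMu localMu_toLocalRing_eq_one_iff)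
open Literature.NumberTheory.Automorphic.IdeleClassGroup (toHeckeCharacter isUnitary_toHeckeCharacter IsConjugateSymplectic)
open Literature.RepresentationTheory.Liu2021 (isOscillatorChar_toHeckeCharacter_iff)

variable (L : Type) [Field L] [NumberField L] [IsCMField L]

local notation3 "cc" => (IsCMField.complexConj L)
local notation3 "L⁺" => (↥(maximalRealSubfield L))

variable (v : HeightOneSpectrum (𝓞 (maximalRealSubfield L))) (N : ℕ) (J : Matrix (Fin N) (Fin N) L) (hN : 2 ≤ N)
  (hJh : (J.map (IsCMField.complexConj L))ᵀ = J) (hJdet : J.det ≠ 0)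

/-- **the rows' own μ-slot has a DIFFERENT companion in the printed Step-2 index set at every place `v ∤ 2` of `L⁺`** (split, inert
or ramified): for every conjugate symplectic `ψ` there is a Step-2 datum `μ'` of the rows' standing data with
`μ'(ε) = −μ_v(ε)` (`μ_v = localMu L (toHeckeCharacter L ψ) v`, `ε = δ ⊗ 1`, `δ = imagUnit L`) and `muOf μ' ≠ muOf μ_v` — the latter
packaged with VERBATIM the rows' displayed proofs. [cite: Liu2021, App. D §D.1 Step 2 (l. 5219); Def. 4.11 (l. 2086)] -/
theorem exists_muOf_ne_localMu_twist (h2 : (2 : 𝓞 L⁺) ∉ v.asIdeal) (ψ : IdeleClassGroup L →ₜ* Circle)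
    (hψ : IsConjugateSymplectic L ψ) :
    ∃ (μ' : (LocalRing L v)ˣ →* ℂˣ) (hμ'n : ∀ x, ‖((μ' x : ℂˣ) : ℂ)‖ = 1) (hμ'c : Continuous fun x => ((μ' x : ℂˣ) : ℂ))
      (hμ'F : ∀ a : (v.adicCompletion L⁺)ˣ,
        μ' (Units.map (algebraMap (v.adicCompletion L⁺) (LocalRing L v)).toMonoidHom a) = 1 ↔
          ∃ x : (LocalRing L v)ˣ, (x : LocalRing L v) * conjLocal L cc v x =
            algebraMap (v.adicCompletion L⁺) (LocalRing L v) a),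
      μ' (LemD1OfPlace.eps L v (imagUnit_ne_zero L)) =
        -localMu L (toHeckeCharacter L ψ) v (LemD1OfPlace.eps L v (imagUnit_ne_zero L)) ∧
      LemD1OfPlace.muOf L v cc N J (complexConj_imagUnit L) (imagUnit_ne_zero L) hN hJh hJdet μ' hμ'n hμ'c hμ'F ≠
        LemD1OfPlace.muOf L v cc N J (complexConj_imagUnit L) (imagUnit_ne_zero L) hN hJh hJdet
          (localMu L (toHeckeCharacter L ψ) v)
          (fun x => norm_localMu L (toHeckeCharacter L ψ) v (isUnitary_toHeckeCharacter L ψ) x)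
          (continuous_localMu L (toHeckeCharacter L ψ) v)
          (fun t => localMu_toLocalRing_eq_one_iff L (toHeckeCharacter L ψ) v
            ((isOscillatorChar_toHeckeCharacter_iff ψ).mpr hψ) t) := by
  obtain ⟨w⟩ := (inferInstance : Nonempty (PlacesOver L v))
  exact exists_muOf_ne_twist L v cc (complexConj_imagUnit L) (imagUnit_ne_zero L) N J hN hJh hJdet w
    (two_not_mem_of_placesOver L v w h2) _ _ _ _

/-- **the printed Step-2 index set of the rows' standing data has at least TWO elements at every place `v ∤ 2` of `L⁺`**
(at a non-split place: new; `LemD1IndexedNonVacuityNonsplitPlace` had one element there, the rows' own `μ_v`).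
[cite: Liu2021, App. D §D.1 Step 2 (l. 5219)] -/
theorem exists_muSet_ne_of_isCMField (h2 : (2 : 𝓞 L⁺) ∉ v.asIdeal) :
    ∃ μ₁ μ₂ : LemD1.MuSet (LemD1OfPlace.standingData L v cc N J (complexConj_imagUnit L) (imagUnit_ne_zero L) hN hJh hJdet),
      μ₁ ≠ μ₂ := by
  obtain ⟨w⟩ := (inferInstance : Nonempty (PlacesOver L v))
  obtain ⟨μ⟩ := LemD1IndexedNonVacuityNonsplitPlace.nonempty_muSet_of_isCMField L v N J hN hJh hJdet
  obtain ⟨μ', hne, -⟩ := exists_muSet_ne_twist L v cc (complexConj_imagUnit L) (imagUnit_ne_zero L) N J hN hJh hJdet w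
    (two_not_mem_of_placesOver L v w h2) μ
  exact ⟨μ', μ, hne⟩

/-- **the μ-teeth of [Lem. D.1 (3)] AS PRINTED bite at EVERY place `v ∤ 2` of `L⁺` with the rows' OWN `μ_v` as one label** (rank
`N ≥ 3`): for every conjugate symplectic `ψ` the two-member collection with labels `(μ_v, ε, 1)`, `(μ', ε, 1)` (`μ'` the tame companion,
`μ'(ε) = −μ_v(ε)`) on trivial-line carriers satisfies (1) member by member and VIOLATES `LemD1_3AsPrintedI`.  In the tree so far this was
available at split places (`…AtPlace` §9) and at the infinitely many split places where `μ_v² ≠ 1` (`…WeightOne`, `…PlaceDichotomy`);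
at a NON-SPLIT place it is new. [cite: Liu2021, App. D Lemma D.1 (1) and (3) (l. 5229, 5233)] -/
theorem exists_lemD1IndexedFamily_item1_not_lemD1_3_localMu_twist (h2 : (2 : 𝓞 L⁺) ∉ v.asIdeal) (h3 : 3 ≤ N)
    (ψ : IdeleClassGroup L →ₜ* Circle) (hψ : IsConjugateSymplectic L ψ) :
    ∃ Lf : LemD1IndexedFamily (v.adicCompletion L⁺) (LocalRing L v) N (Fin 2),
      Lf.S = LemD1OfPlace.standingData L v cc N J (complexConj_imagUnit L) (imagUnit_ne_zero L) hN hJh hJdet ∧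
      (∀ i, (Lf.eps i).1 = LemD1OfPlace.eps L v (imagUnit_ne_zero L)) ∧ (∀ i, (Lf.chi i).1 = 1) ∧
      (Lf.mu 0).1 = localMu L (toHeckeCharacter L ψ) v ∧
      (Lf.mu 1).1 (LemD1OfPlace.eps L v (imagUnit_ne_zero L)) =
        -localMu L (toHeckeCharacter L ψ) v (LemD1OfPlace.eps L v (imagUnit_ne_zero L)) ∧
      Lf.Item1AsPrinted ∧ Lf.mu 0 ≠ Lf.mu 1 ∧ ¬ LemD1_3AsPrintedI Lf := by
  obtain ⟨w⟩ := (inferInstance : Nonempty (PlacesOver L v))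
  have hN2 : 2 ≤ N := by omega
  exact exists_lemD1IndexedFamily_item1_not_lemD1_3_twist L v cc (complexConj_imagUnit L) (imagUnit_ne_zero L) N J hN hJh
    hJdet w (two_not_mem_of_placesOver L v w h2) h3
    (LemD1OfPlace.muOf L v cc N J (complexConj_imagUnit L) (imagUnit_ne_zero L) hN hJh hJdet
      (localMu L (toHeckeCharacter L ψ) v)
      (fun x => norm_localMu L (toHeckeCharacter L ψ) v (isUnitary_toHeckeCharacter L ψ) x)
      (continuous_localMu L (toHeckeCharacter L ψ) v)
      (fun t => localMu_toLocalRing_eq_one_iff L (toHeckeCharacter L ψ) v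
        ((isOscillatorChar_toHeckeCharacter_iff ψ).mpr hψ) t))
    (LemD1OfPlace.epsDelta L v cc N J (complexConj_imagUnit L) (imagUnit_ne_zero L) hN hJh hJdet)

/-- **a RAMIFIED Step-2 datum of the rows' standing data at every place of `L⁺` with an inert witness and `∤ 2`**: at a place
`w ∣ v` of `L` with `π ∈ L⁺_vˣ` of `w`-valuation `exp(−1)` (every place unramified in `L`, `…InertCofinite`), `v ∤ 2`, there is an element
`μ'` of the printed Step-2 index set and a unit `u ∈ L_vˣ` of `w`-valuation `1` with `μ'(u) ≠ 1` — whereas the rows' OWN `μ_v` is trivial on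
such units as soon as `ψ` is unramified at `w` (`…InertRigidity` §3), and the unramified Step-2 datum is unique there (§2 ibid.): at an
inert place `∤ 2` the printed index set is NOT reduced to the rows' label. [cite: Liu2021, App. D §D.1 Step 2 (l. 5219), Lemma D.1 (3) (l. 5233)] -/
theorem exists_muSet_apply_unit_ne_one_of_inertWitness (h2 : (2 : 𝓞 L⁺) ∉ v.asIdeal) (w : PlacesOver L v)
    (π : (v.adicCompletion L⁺)ˣ) (hπ : Valued.v (toPlace v w (π : v.adicCompletion L⁺)) = WithZero.exp (-1 : ℤ)) :
    ∃ μ' : LemD1.MuSet (LemD1OfPlace.standingData L v cc N J (complexConj_imagUnit L) (imagUnit_ne_zero L) hN hJh hJdet),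
      ∃ u : (LocalRing L v)ˣ, Valued.v ((u : LocalRing L v) w) = 1 ∧ μ'.1 u ≠ 1 := by
  obtain ⟨μ⟩ := LemD1IndexedNonVacuityNonsplitPlace.nonempty_muSet_of_isCMField L v N J hN hJh hJdet
  obtain ⟨μ', hμ'n, hμ'c, hμ'F, u, hu, hne⟩ := exists_stepTwo_apply_unit_ne_one L v cc (complexConj_imagUnit L)
    (imagUnit_ne_zero L) w (two_not_mem_of_placesOver L v w h2) π hπ μ.1 μ.2.1 μ.2.2.1 μ.2.2.2
  exact ⟨LemD1OfPlace.muOf L v cc N J (complexConj_imagUnit L) (imagUnit_ne_zero L) hN hJh hJdet μ' hμ'n hμ'c hμ'F, u, hu, hne⟩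

omit [IsCMField L] in
/-- **all but finitely many places of `L⁺` are `∤ 2`**: the exceptional set of this file is the (finite) set of prime factors of `2`
(Mathlib `Ideal.finite_factors`). [cite: NeukirchANT1999, Ch. I §8] -/
theorem finite_setOf_two_mem : {v : HeightOneSpectrum (𝓞 L⁺) | (2 : 𝓞 L⁺) ∈ v.asIdeal}.Finite := by
  have h := Ideal.finite_factors (I := Ideal.span {(2 : 𝓞 L⁺)}) (by
    rw [Ideal.zero_eq_bot, Ne, Ideal.span_singleton_eq_bot]; exact two_ne_zero)
  refine h.subset fun v hv => ?_
  simp only [Set.mem_setOf_eq] at hv ⊢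
  rw [Ideal.dvd_span_singleton]
  exact hv

/-- **cofinite form**: at all but finitely many places `v` of `L⁺` the printed Step-2 index set of the rows' standing data has two
distinct elements. [cite: Liu2021, App. D §D.1 Step 2 (l. 5219)] -/
theorem eventually_exists_muSet_ne :
    ∀ᶠ v : HeightOneSpectrum (𝓞 L⁺) in Filter.cofinite,
      ∃ μ₁ μ₂ : LemD1.MuSet (LemD1OfPlace.standingData L v cc N J (complexConj_imagUnit L) (imagUnit_ne_zero L) hN hJh hJdet),
        μ₁ ≠ μ₂ :=
  Filter.Eventually.mono (finite_setOf_two_mem L).compl_mem_cofinite fun v hv =>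
    exists_muSet_ne_of_isCMField L v N J hN hJh hJdet hv

end CM

end Literature.NumberTheory.Automorphic.Liu2021.LemD1IndexedNonVacuityTameTwist

end
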